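import Literature.IUT.HodgeArakelov.CohomologySystemOfContH1
import Literature.AnabelianGeometry.EtaleTheta.ContH1ConjAction
import Mathlib.Topology.Algebra.OpenSubgroup
import Mathlib.Topology.Homeomorph.Lemmas
import Mathlib.GroupTheory.Index

/-!
# Divisibility in [IUTchII] Prop. 1.4's `lim_J H¹(H|_J, A)`: roots of cocycles, torsion classes, and a
# normal "divisibility level" for a stable family of cocycles (generic support file)

S. Mochizuki, *Inter-universal Teichmüller theory II*, kurims manuscript (Dec. 2020), Prop. 1.4 p. 27 /
Prop. 2.2 (ii) p. 66 ("`∞θ(Π) ⊆ lim_J H¹(Π_Ÿ(Π)|_J, (l·Δ_Θ)(Π))`", the `N`-th roots of the classes of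
`θ(Π)` in the limit) [claim: Mochizuki2012, status: disputed]. abc-iut cell, layer L6, node IUTchII:Prop2.2(ii),
sub-DAG row Prop-22.ii.r13a (abc-iut-w5-d187): the «respectively» clause at the model is proved modulo the
binder `hdiv` — "the classes of `θ(Π_v)` are divisible in `lim_J`" (`IotaInvariantThetaInftyModel.lean`,
p414969). This GENERIC file supplies the group-cohomological mechanism by which such divisibility is
established over the instantiated system `cohomologySystemOfContH1 φ A H` (`CohomologySystemOfContH1.lean`,
abc-iut-L6-t1) and L2's continuous `H¹` (`ContH1`, abc-iut-L2-t1) — classical material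
[cite: NeukirchSchmidtWingberg2008, I §2 and II §7]:

* `DivisibleLevel.exists_cocycle_pow_eq` — ROOTS OF COCYCLES: a continuous cocycle all of whose values
  are `N`-th powers is the `N`-th power of a continuous cocycle, provided `A` has no `N`-torsion and `N`-th
  roots can be chosen continuously on `A^N` (`exists_continuous_root`: automatic when `A` is compact
  Hausdorff and `a ↦ a^N` is injective);
* `DivisibleLevel.forall_isPow_of_pow_eq_one` — TORSION CLASSES: an `l`-torsion class has `N`-th-power
  values on any subgroup acting trivially on `A` modulo `(lN)`-th powers;
* `DivisibleLevel.level` / `level_normal` / `isOpen_level` / `finiteIndex_level` — the DIVISIBILITY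
  LEVEL of a conjugation-stable family `𝒞` of cocycles on a normal `H`: the subgroup of `H ∩ K` (`K` open
  normal of finite index acting trivially mod `A^M`) where every member of `𝒞` takes values in `A^M` is
  NORMAL in `G`; it is open and of finite index in `H` as soon as `𝒞` has finitely many members modulo
  `A^M` on `H ∩ K` (`A^M` open of finite index in `A`);
* `toLim_mem_of_res_eq_pow` — in `cohomologySystemOfContH1 φ A H`: if the restriction of `t ∈ H1 ⊤` to a
  finite-index open `J` is an `N`-th power in `H¹(H ⊓ J, A)`, then `N • x = toLim ⊤ t` for some `x ∈ lim`.

No definitions of mathematical objects beyond the auxiliary subgroup `DivisibleLevel.level`; nothing of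
[IUTchII]/[EtTh] asserted; no side taken on [IUTchIII] Cor. 3.12.
-/

namespace Literature.IUT.HodgeArakelov

open Literature.AnabelianGeometry.EtaleTheta Topology

noncomputable section

namespace DivisibleLevel

section Generic

variable {G G' : Type*} [Group G] [TopologicalSpace G]
  [Group G'] [TopologicalSpace G'] [IsTopologicalGroup G']
  {φ : G →* G'} {A : Subgroup G'} [A.Normal] [IsMulCommutative A] {H : Subgroup G}

open scoped IsMulCommutative

/-! ### Roots of cocycles -/

omit [TopologicalSpace G'] [IsTopologicalGroup G'] [A.Normal] in
/-- No `N`-torsion: `a^N = b^N ⇒ a = b`. [cite: NeukirchSchmidtWingberg2008, I §2 and II §7] -/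
theorem eq_of_pow_eq {N : ℕ} (htf : ∀ a : A, a ^ N = 1 → a = 1) {a b : A} (h : a ^ N = b ^ N) : a = b := by
  have h1 : (a * b⁻¹) ^ N = 1 := by rw [mul_pow, inv_pow, h, mul_inv_cancel]
  have := htf _ h1
  rwa [mul_inv_eq_one] at this

/-- **Roots of cocycles.** If every value of a continuous cocycle `f : H → A` is an `N`-th power, `A` has no
`N`-torsion, and `N`-th roots can be chosen CONTINUOUSLY on `A^N` (`r`), then `f = d^N` for a continuous
cocycle `d` (namely `d = r ∘ f`: the cocycle identity for `d` holds after raising to the `N`-th power, hence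
holds). [cite: NeukirchSchmidtWingberg2008, I §2 and II §7] -/
theorem exists_cocycle_pow_eq {N : ℕ} (r : {a : A // ∃ b : A, b ^ N = a} → A) (hr : Continuous r)
    (hrN : ∀ a, (r a) ^ N = a.1) (htf : ∀ a : A, a ^ N = 1 → a = 1)
    (f : contCocycles φ A H) (hval : ∀ g, ∃ b : A, b ^ N = f.1 g) :
    ∃ d : contCocycles φ A H, d ^ N = f := by
  let d₀ : H → A := fun g => r ⟨f.1 g, hval g⟩
  have hd₀ : ∀ g, (d₀ g) ^ N = f.1 g := fun g => hrN ⟨f.1 g, hval g⟩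
  have hd : d₀ ∈ contCocycles φ A H := by
    refine ⟨hr.comp (f.2.1.subtype_mk _), fun g h => ?_⟩
    apply eq_of_pow_eq htf
    rw [hd₀, f.2.2 g h, mul_pow, ← map_pow, hd₀, hd₀]
  refine ⟨⟨d₀, hd⟩, Subtype.ext (funext fun g => ?_)⟩
  change ((⟨d₀, hd⟩ : contCocycles φ A H) ^ N).1 g = f.1 g
  rw [SubmonoidClass.coe_pow, Pi.pow_apply]
  exact hd₀ g

/-- Class form: under the same hypotheses `[f] = [d]^N` in `H¹(H, A)`. [cite: NeukirchSchmidtWingberg2008, I §2 and II §7] -/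
theorem exists_class_pow_eq {N : ℕ} (r : {a : A // ∃ b : A, b ^ N = a} → A) (hr : Continuous r)
    (hrN : ∀ a, (r a) ^ N = a.1) (htf : ∀ a : A, a ^ N = 1 → a = 1)
    (f : contCocycles φ A H) (hval : ∀ g, ∃ b : A, b ^ N = f.1 g) :
    ∃ y : ContH1 φ A H, y ^ N = ContH1.mk f.1 f.2 := by
  obtain ⟨d, hd⟩ := exists_cocycle_pow_eq r hr hrN htf f hval
  refine ⟨ContH1.mk d.1 d.2, ?_⟩
  change (QuotientGroup.mk d : contCocycles φ A H ⧸ (contCoboundaries φ A H).subgroupOf (contCocycles φ A H)) ^ N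
    = QuotientGroup.mk f
  rw [← QuotientGroup.mk_pow, hd]

omit [A.Normal] [IsMulCommutative A] in
/-- **Continuous roots exist when `A` is compact Hausdorff** and `a ↦ a^N` is injective: the `N`-th power map
is then a closed embedding, i.e. a homeomorphism onto `A^N`. [cite: NeukirchSchmidtWingberg2008, I §2 and II §7] -/
theorem exists_continuous_root [CompactSpace A] [T2Space A] (N : ℕ)
    (hinj : Function.Injective fun a : A => a ^ N) :
    ∃ r : {a : A // ∃ b : A, b ^ N = a} → A, Continuous r ∧ ∀ a, (r a) ^ N = a.1 := by
  have hcont : Continuous fun a : A => a ^ N := continuous_id.pow N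
  have hemb : IsEmbedding fun a : A => a ^ N := (hcont.isClosedEmbedding hinj).isEmbedding
  let e := hemb.toHomeomorph
  refine ⟨fun a => e.symm ⟨a.1, a.2⟩, e.symm.continuous.comp (by fun_prop), fun a => ?_⟩
  have h := e.apply_symm_apply ⟨a.1, a.2⟩
  have h' := congrArg Subtype.val h
  rw [IsEmbedding.toHomeomorph_apply_coe] at h'
  exact h'

/-! ### Torsion classes -/

/-- **Torsion classes have divisible values deep enough.** If `[f]^l = 1` in `H¹(H, A)`, `A` has no
`l`-torsion, and every `g ∈ H₂ ≤ H` acts trivially on `A` modulo `(lN)`-th powers, then every value of `f`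
on `H₂` is an `N`-th power (`f^l = ∂a`, so `f(g)^l = (ᵍa)a⁻¹ = e^{lN}` and `f(g) = e^N`).
[cite: NeukirchSchmidtWingberg2008, I §2 and II §7] -/
theorem forall_isPow_of_pow_eq_one (f : contCocycles φ A H) {l N : ℕ}
    (hl : (QuotientGroup.mk f : ContH1 φ A H) ^ l = 1) (htf : ∀ a : A, a ^ l = 1 → a = 1)
    {H₂ : Subgroup G} (hH₂ : H₂ ≤ H)
    (htriv : ∀ g ∈ H₂, ∀ b : A, ∃ e : A, e ^ (l * N) = MulAut.conjNormal (φ g) b * b⁻¹) :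
    ∀ g : H₂, ∃ b : A, b ^ N = (ContH1.resCocycle φ A hH₂ f).1 g := by
  rw [← QuotientGroup.mk_pow, QuotientGroup.eq_one_iff, Subgroup.mem_subgroupOf,
    mem_contCoboundaries_iff] at hl
  obtain ⟨a, ha⟩ := hl
  intro g
  obtain ⟨e, he⟩ := htriv g g.2 a
  refine ⟨e, ?_⟩
  apply eq_of_pow_eq htf
  have h1 : (f ^ l).1 ⟨g, hH₂ g.2⟩ = MulAut.conjNormal (φ ((⟨g, hH₂ g.2⟩ : H) : G)) a * a⁻¹ :=
    congrFun ha ⟨g, hH₂ g.2⟩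
  rw [SubmonoidClass.coe_pow, Pi.pow_apply] at h1
  change (e ^ N) ^ l = (f.1 ⟨g, hH₂ g.2⟩) ^ l
  rw [h1, ← pow_mul, mul_comm N l, he]

end Generic

end DivisibleLevel

/-! ### Divisibility in the limit of `cohomologySystemOfContH1` -/

section System

open CohomologySystemOfContH1

universe u

variable {P : TopGroup.{u}} {G' : Type u} [Group G'] [TopologicalSpace G'] [IsTopologicalGroup G']
  (φ : P →* G') (A : Subgroup G') [A.Normal] [IsMulCommutative A] (H : Subgroup P)

/-- In the instantiated system ([IUTchII] Prop. 1.4 p. 27: `J ↦ H¹(H|_J, A)`, `lim_J`): if the restriction of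
`t ∈ H1 ⊤` to a finite-index open `J` is an `N`-th power `y^N` in `H¹(H ⊓ J, A)`, then `toLim ⊤ t = N • x`
with `x = toLim J y`. [cite: Mochizuki2012, Prop 1.4 p.27] -/
theorem toLim_top_eq_nsmul_of_res_eq_pow (t : (cohomologySystemOfContH1 φ A H).H1 ⊤)
    (J : Subgroup P) (hJ : J.FiniteIndex) (hJo : IsOpen (J : Set P)) (N : ℕ) (y : ContH1 φ A (H ⊓ J))
    (hy : Additive.ofMul (y ^ N) = h1EquivOfFiniteIndexOpen φ A H J hJ hJo
      ((cohomologySystemOfContH1 φ A H).res (le_top : J ≤ ⊤) t)) :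
    ∃ x : (cohomologySystemOfContH1 φ A H).lim, N • x = (cohomologySystemOfContH1 φ A H).toLim ⊤ t := by
  let S := cohomologySystemOfContH1 φ A H
  let e : S.H1 J ≃+ Additive (ContH1 φ A (H ⊓ J)) := h1EquivOfFiniteIndexOpen φ A H J hJ hJo
  have he : ∀ u, e u = h1EquivOfFiniteIndexOpen φ A H J hJ hJo u := fun _ => rfl
  refine ⟨S.toLim J (e.symm (Additive.ofMul y)), ?_⟩
  have h1 : N • e.symm (Additive.ofMul y) = S.res (le_top : J ≤ ⊤) t := by
    apply e.injective
    rw [map_nsmul, AddEquiv.apply_symm_apply, ← ofMul_pow, hy, he]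
  calc N • S.toLim J (e.symm (Additive.ofMul y))
      = S.toLim J (N • e.symm (Additive.ofMul y)) := (map_nsmul _ _ _).symm
    _ = S.toLim J (S.res (le_top : J ≤ ⊤) t) := by rw [h1]
    _ = S.toLim ⊤ t := S.toLim_res _ _

/-- The same for a class GIVEN at `⊤` by a class `z ∈ H¹(H ⊓ ⊤, A)` (`t = (H1 ⊤ ≅ H¹(H ⊓ ⊤, A))⁻¹ z`): if
`res_{H ⊓ ⊤ → H ⊓ J} z = y^N` for a finite-index open `J`, then `toLim ⊤ t ∈ N • lim`.
[cite: Mochizuki2012, Prop 1.4 p.27] -/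
theorem toLim_top_symm_eq_nsmul_of_res_eq_pow (z : ContH1 φ A (H ⊓ ⊤))
    (J : Subgroup P) (hJ : J.FiniteIndex) (hJo : IsOpen (J : Set P)) (N : ℕ) (y : ContH1 φ A (H ⊓ J))
    (hy : y ^ N = ContH1.res φ A (inf_le_inf_left H (le_top : J ≤ ⊤)) z) :
    ∃ x : (cohomologySystemOfContH1 φ A H).lim,
      N • x = (cohomologySystemOfContH1 φ A H).toLim ⊤
        ((h1EquivOfFiniteIndexOpen φ A H ⊤ inferInstance (by simp)).symm (Additive.ofMul z)) := by
  refine toLim_top_eq_nsmul_of_res_eq_pow φ A H _ J hJ hJo N y ?_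
  have hres : (cohomologySystemOfContH1 φ A H).res (le_top : J ≤ ⊤)
      ((h1EquivOfFiniteIndexOpen φ A H ⊤ inferInstance (by simp)).symm (Additive.ofMul z)) =
      h1Res φ A H (le_top : J ≤ ⊤)
        ((h1EquivOfFiniteIndexOpen φ A H ⊤ inferInstance (by simp)).symm (Additive.ofMul z)) := rfl
  rw [hres, h1Equiv_h1Res φ A H inferInstance (by simp) hJ hJo le_top, AddEquiv.apply_symm_apply, hy]
  rfl

end System

end

end Literature.IUT.HodgeArakelov
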